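import Summits.Ventures.HodgeRepro2.T5SU11ResolventBoundaryEdge
import Summits.Ventures.HodgeRepro2.T5SU11ResolventDiagonal

/-!
# The diagonalisation of the resolvent at the bottom of the spectrum: `⟨G_λ f, Ξ⟩ = −⟨f, Ξ⟩/(λ−1)²`

Rows 469–470 diagonalised the resolvent on `φ_{λ′}` for `1 < λ′ < λ`; this row is the edge `λ′ = 1`, `φ_1 = Ξ`
(the Harish-Chandra function, the bottom `−ρ² = −1` of the spectrum of the radial Laplacian). The same Green's
identity (row 467) for `u = G_λ f` and `v = Ξ` on `[ε, R]` has boundary terms `W(ε) = −c₁ (λ(λ−2) + 1)∫_0^ε sinh 2t φ_λ Ξ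
→ 0` (`tendsto_green_bracket_left_one`; row 338's Lagrange identity) and `W(R) → 0` (`tendsto_green_bracket_right_one`;
row 480), and `(G_λ f) Ξ sinh 2t` is integrable on `(0, ∞)` (`integrableOn_green_mul_sph_one`: on `(b, ∞)` it is
`≤ c₂ L (α + βt) e^{(1−λ)t}`, and `t ≤ e^{δt}/δ` makes this an exponential majorant). The passage `ε → 0⁺`
(`resolvent_transform_finite_one`), `R → ∞` (`resolvent_transform_one`) then gives

  **`(1·(1−2) − λ(λ−2)) ∫_{(0,∞)} (G_λ f) Ξ sinh 2t = ∫_a^b f Ξ sinh 2t`**, i.e.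
  **`∫_{(0,∞)} (G_λ f)(t) Ξ(a_t) sinh 2t dt = −(∫_{(0,∞)} f(t) Ξ(a_t) sinh 2t dt) / (λ−1)²`**  (`sphTransform_sphGreen_one`),

for every `λ > 1`: the spectral multiplier of the resolvent at the bottom of the spectrum is exactly `−1/(λ−1)²` — the
sharp resolvent bound `‖G_λ‖ ≤ 1/(λ−1)²` of row 478 is the value of the multiplier on the ground state. Nothing is
claimed about (N).

Blind lane: Mathlib + the HodgeRepro2 prefix only; no sorry; axioms ⊆ {propext, Classical.choice,
Quot.sound}.
-/

namespace Summit.Ventures.HodgeRepro2.T5SU11ResolventDiagonalEdge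

open Filter Topology MeasureTheory intervalIntegral
open Set (Ioi Ioc Icc uIcc)
open T5SU11Cartan T5SU11SphericalFunction T5SU11SphericalBounds T5SU11SphericalContinuous
  T5SU11SphericalAsymptotic T5SU11SphericalCfun T5SU11SphericalUnique T5SU11ReductionOfOrder
  T5SU11ReductionOfOrderInfinity T5SU11SphericalSolutionSpaceAll T5SU11SphericalDecay
  T5SU11SphericalDecayAsymptotic T5SU11RadialGreen T5SU11SphericalGreen T5SU11GreenIdentityInhomogeneous
  T5SU11ResolventBoundary T5SU11ResolventTransform T5SU11ResolventDiagonal T5SU11SphericalDecayBracket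
  T5SU11GroundStateTransform T5SU11ResolventBoundaryEdge

/-- `t ≤ e^{δt}/δ` for `δ > 0`. -/
theorem le_exp_div {δ t : ℝ} (hδ : 0 < δ) : t ≤ Real.exp (δ * t) / δ := by
  rw [le_div_iff₀ hδ]
  have := Real.add_one_le_exp (δ * t)
  nlinarith

section measure

variable [MeasurableSpace Circle] [BorelSpace Circle]

variable {lam a b : ℝ} {f : ℝ → ℝ} (hlam : 1 < lam) (hf : ContinuousOn f (Ioi 0))
  (ha : 0 < a) (hab : a ≤ b) (hfa : ∀ s, s ≤ a → f s = 0) (hfb : ∀ s, b ≤ s → f s = 0)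

/-! ### The boundary terms -/

include hlam hf ha hab hfa in
/-- **`W(ε) → 0` as `ε → 0⁺`** for `v = Ξ`. -/
theorem tendsto_green_bracket_left_one :
    Tendsto (fun ε => Real.sinh (2 * ε) * (sph 1 (hyp ε) * sphGreen' lam f a b ε
            - sphGreen lam f a b ε * deriv (fun t => sph 1 (hyp t)) ε)) (𝓝[>] 0) (𝓝 0) := by
  have h0 := tendsto_integral_sph_mul_nhdsGT_zero (lam := lam) (lam' := 1)
  have h := (h0.const_mul (lam * (lam - 2) - 1 * (1 - 2))).const_mul
    (-(∫ s in a..b, sphDecay lam s * f s * Real.sinh (2 * s)))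
  simp only [mul_zero] at h
  refine h.congr' ?_
  filter_upwards [Ioo_mem_nhdsGT ha] with ε hε
  obtain ⟨hu, hu'⟩ := sphGreen_of_le (lam := lam) (lam' := (1 + lam) / 2) (by linarith) (by linarith) hf ha hab hfa
    hε.1 hε.2.le
  rw [hu, hu', lagrange_identity lam 1 ε]
  ring

include hlam hf ha hab hfb in
/-- **`W(R) → 0` as `R → ∞`** for `v = Ξ` (row 480). -/
theorem tendsto_green_bracket_right_one :
    Tendsto (fun R => Real.sinh (2 * R) * (sph 1 (hyp R) * sphGreen' lam f a b R
            - sphGreen lam f a b R * deriv (fun t => sph 1 (hyp t)) R)) atTop (𝓝 0) := by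
  have h := (tendsto_green_bracket_decay_one hlam).const_mul
    (-(∫ s in a..b, sph lam (hyp s) * f s * Real.sinh (2 * s)))
  rw [mul_zero] at h
  refine h.congr' ?_
  filter_upwards [eventually_ge_atTop b] with R hR
  exact (green_bracket_right (lam' := 1) hf ha hab hfb hR).symm

/-! ### Integrability -/

include hlam hf ha hab in
/-- `(G_λ f) Ξ sinh 2t` is continuous on `(0, ∞)`. -/
theorem continuousOn_green_mul_sph_one :
    ContinuousOn (fun t => sphGreen lam f a b t * sph 1 (hyp t) * Real.sinh (2 * t)) (Ioi 0) := by
  have hu : ContinuousOn (sphGreen lam f a b) (Ioi 0) :=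
    fun t ht => (hasDerivAt_sphGreen hlam hf ha hab ht).continuousAt.continuousWithinAt
  exact (hu.mul (continuous_sph_hyp 1).continuousOn).mul
    (Real.continuous_sinh.comp (continuous_const.mul continuous_id)).continuousOn

include hlam hf ha hab hfa hfb in
/-- **`(G_λ f) Ξ sinh 2t` is integrable on `(0, ∞)`.** -/
theorem integrableOn_green_mul_sph_one :
    IntegrableOn (fun t => sphGreen lam f a b t * sph 1 (hyp t) * Real.sinh (2 * t)) (Ioi 0) := by
  have hb : 0 < b := lt_of_lt_of_le ha hab
  set c₁ := ∫ s in a..b, sphDecay lam s * f s * Real.sinh (2 * s) with hc₁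
  set c₂ := ∫ s in a..b, sph lam (hyp s) * f s * Real.sinh (2 * s) with hc₂
  have hcont := continuousOn_green_mul_sph_one hlam hf ha hab
  have hI1 : IntegrableOn (fun t => sphGreen lam f a b t * sph 1 (hyp t) * Real.sinh (2 * t)) (Ioc 0 a) := by
    have hg : Continuous fun t => -c₁ * sph lam (hyp t) * sph 1 (hyp t) * Real.sinh (2 * t) :=
      (((continuous_const.mul (continuous_sph_hyp lam)).mul (continuous_sph_hyp 1)).mul
        (Real.continuous_sinh.comp (continuous_const.mul continuous_id)))
    refine (hg.integrableOn_Icc.mono_set Set.Ioc_subset_Icc_self).congr_fun (fun t ht => ?_) measurableSet_Ioc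
    rw [(sphGreen_of_le (lam := lam) (lam' := (1 + lam) / 2) (by linarith) (by linarith) hf ha hab hfa ht.1 ht.2).1]
  have hI2 : IntegrableOn (fun t => sphGreen lam f a b t * sph 1 (hyp t) * Real.sinh (2 * t)) (Ioc a b) :=
    ((hcont.mono (fun t ht => lt_of_lt_of_le ha ht.1)).integrableOn_Icc).mono_set Set.Ioc_subset_Icc_self
  have hI3 : IntegrableOn (fun t => sphGreen lam f a b t * sph 1 (hyp t) * Real.sinh (2 * t)) (Ioi b) := by
    set L := 1 / ((lam - 1) * cfun (2 - lam)) with hL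
    have hLpos : 0 < L := sphDecay_limit_pos hlam
    obtain ⟨α, β, hα, hβ, hΞle⟩ := exists_exp_mul_sph_one_hyp_le
    obtain ⟨T₀, hT₀⟩ := eventually_atTop.mp (eventually_sphDecay_le hlam)
    set δ := (lam - 1) / 2 with hδ
    have hδpos : 0 < δ := by rw [hδ]; linarith
    set T := max T₀ b with hT
    have hbT : b ≤ T := le_max_right _ _
    have hJ1 : IntegrableOn (fun t => sphGreen lam f a b t * sph 1 (hyp t) * Real.sinh (2 * t)) (Ioc b T) :=
      ((hcont.mono (fun t ht => lt_of_lt_of_le hb ht.1)).integrableOn_Icc).mono_set Set.Ioc_subset_Icc_self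
    have hJ2 : IntegrableOn (fun t => sphGreen lam f a b t * sph 1 (hyp t) * Real.sinh (2 * t)) (Ioi T) := by
      -- the majorant `|c₂| L (α e^{−(λ−1)t} + (β/δ) e^{−δ t})`
      have hmaj : IntegrableOn (fun t => |c₂| * L * (α * Real.exp (-(lam - 1) * t)
          + β / δ * Real.exp (-δ * t))) (Ioi T) :=
        (((exp_neg_integrableOn_Ioi T (by linarith : 0 < lam - 1)).const_mul α).add
          ((exp_neg_integrableOn_Ioi T hδpos).const_mul (β / δ))).const_mul _
      refine hmaj.mono' ?_ ?_
      · exact (hcont.mono (Set.Ioi_subset_Ioi (le_trans hb.le hbT))).aestronglyMeasurable measurableSet_Ioi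
      · refine ae_restrict_of_forall_mem measurableSet_Ioi (fun t ht => ?_)
        have ht' : T < t := ht
        have htb : b ≤ t := le_trans hbT ht'.le
        have ht0 : 0 < t := lt_of_lt_of_le hb htb
        have hb1 := hT₀ t (le_trans (le_max_left _ _) ht'.le)
        rw [(sphGreen_of_ge hf ha hab hfb htb).1, Real.norm_eq_abs]
        have hs : Real.sinh (2 * t) ≤ Real.exp (2 * t) / 2 := sinh_le_exp_div_two _
        have hs0 : 0 ≤ Real.sinh (2 * t) := Real.sinh_nonneg_iff.mpr (by linarith)
        have hχ0 : 0 ≤ sphDecay lam t := (sphDecay_pos hlam ht0).le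
        have hΞ0 : 0 ≤ sph 1 (hyp t) := (sph_hyp_pos 1 t).le
        have hΞ : sph 1 (hyp t) ≤ (α + β * t) * Real.exp (-t) := by
          rw [Real.exp_neg, ← div_eq_mul_inv, le_div_iff₀ (Real.exp_pos t), mul_comm]
          exact hΞle t ht0.le
        have htδ : t ≤ Real.exp (δ * t) / δ := le_exp_div hδpos
        rw [abs_mul, abs_mul, abs_mul, abs_neg, abs_of_nonneg hχ0, abs_of_nonneg hΞ0, abs_of_nonneg hs0]
        calc |c₂| * sphDecay lam t * sph 1 (hyp t) * Real.sinh (2 * t)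
            ≤ |c₂| * (2 * L * Real.exp (-lam * t)) * ((α + β * t) * Real.exp (-t)) * (Real.exp (2 * t) / 2) :=
              mul_le_mul (mul_le_mul (mul_le_mul_of_nonneg_left hb1 (abs_nonneg _)) hΞ hΞ0 (by positivity))
                hs hs0 (by positivity)
          _ = |c₂| * L * ((α + β * t) * Real.exp (-(lam - 1) * t)) := by
              rw [show Real.exp (-(lam - 1) * t) = Real.exp (-lam * t) * Real.exp (-t) * Real.exp (2 * t) by
                rw [← Real.exp_add, ← Real.exp_add]; congr 1; ring]
              ring
          _ ≤ |c₂| * L * (α * Real.exp (-(lam - 1) * t) + β / δ * Real.exp (-δ * t)) := by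
              refine mul_le_mul_of_nonneg_left ?_ (by positivity)
              have hE : 0 < Real.exp (-(lam - 1) * t) := Real.exp_pos _
              have key : Real.exp (δ * t) / δ * Real.exp (-(lam - 1) * t) = Real.exp (-δ * t) / δ := by
                rw [div_mul_eq_mul_div, ← Real.exp_add]
                congr 2
                rw [hδ]; ring
              calc (α + β * t) * Real.exp (-(lam - 1) * t)
                  = α * Real.exp (-(lam - 1) * t) + β * (t * Real.exp (-(lam - 1) * t)) := by ring
                _ ≤ α * Real.exp (-(lam - 1) * t) + β * (Real.exp (δ * t) / δ * Real.exp (-(lam - 1) * t)) := by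
                    gcongr
                _ = α * Real.exp (-(lam - 1) * t) + β / δ * Real.exp (-δ * t) := by
                    rw [key]; ring
    have := hJ1.union hJ2
    rwa [Set.Ioc_union_Ioi_eq_Ioi hbT] at this
  have h12 := hI1.union hI2
  rw [Set.Ioc_union_Ioc_eq_Ioc ha.le hab] at h12
  have := h12.union hI3
  rwa [Set.Ioc_union_Ioi_eq_Ioi hb.le] at this

/-! ### The passage to the limit -/

include hlam hf ha hab hfa in
/-- `∫_0^ε u Ξ sinh 2t = −c₁ ∫_0^ε sinh 2t φ_λ Ξ` for `0 < ε ≤ a`. -/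
theorem integral_green_mul_sph_one_of_le {ε : ℝ} (hε : 0 < ε) (hεa : ε ≤ a) :
    ∫ t in (0 : ℝ)..ε, sphGreen lam f a b t * sph 1 (hyp t) * Real.sinh (2 * t)
      = -(∫ s in a..b, sphDecay lam s * f s * Real.sinh (2 * s))
        * ∫ t in (0 : ℝ)..ε, Real.sinh (2 * t) * sph lam (hyp t) * sph 1 (hyp t) := by
  rw [← intervalIntegral.integral_const_mul]
  refine integral_congr_ae (Filter.Eventually.of_forall fun t ht => ?_)
  rw [Set.uIoc_of_le hε.le] at ht
  rw [(sphGreen_of_le (lam := lam) (lam' := (1 + lam) / 2) (by linarith) (by linarith) hf ha hab hfa ht.1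
    (le_trans ht.2 hεa)).1]
  ring

include hlam hf ha hab hfa in
/-- `∫_0^ε u Ξ sinh 2t → 0` as `ε → 0⁺`. -/
theorem tendsto_integral_green_mul_sph_one_nhdsGT_zero :
    Tendsto (fun ε => ∫ t in (0 : ℝ)..ε, sphGreen lam f a b t * sph 1 (hyp t) * Real.sinh (2 * t)) (𝓝[>] 0) (𝓝 0) := by
  have h := (tendsto_integral_sph_mul_nhdsGT_zero (lam := lam) (lam' := 1)).const_mul
    (-(∫ s in a..b, sphDecay lam s * f s * Real.sinh (2 * s)))
  rw [mul_zero] at h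
  refine h.congr' ?_
  filter_upwards [Ioo_mem_nhdsGT ha] with ε hε
  exact (integral_green_mul_sph_one_of_le hlam hf ha hab hfa hε.1 hε.2.le).symm

include hlam hf ha hab hfa hfb in
/-- **Green's identity for `u = G_λ f`, `v = Ξ` on `[ε, R]`**, `0 < ε ≤ a`, `b ≤ R`. -/
theorem green_identity_resolvent_one {ε R : ℝ} (hε : 0 < ε) (hεa : ε ≤ a) (hbR : b ≤ R) :
    ∫ t in a..b, f t * sph 1 (hyp t) * Real.sinh (2 * t)
      = (Real.sinh (2 * R) * (sph 1 (hyp R) * sphGreen' lam f a b R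
            - sphGreen lam f a b R * deriv (fun t => sph 1 (hyp t)) R)
          - Real.sinh (2 * ε) * (sph 1 (hyp ε) * sphGreen' lam f a b ε
            - sphGreen lam f a b ε * deriv (fun t => sph 1 (hyp t)) ε))
        + (1 * (1 - 2) - lam * (lam - 2)) * ∫ t in ε..R, sphGreen lam f a b t * sph 1 (hyp t) * Real.sinh (2 * t) := by
  have hb : 0 < b := lt_of_lt_of_le ha hab
  have hR : 0 < R := lt_of_lt_of_le hb hbR
  have hεR : ε ≤ R := le_trans hεa (le_trans hab hbR)
  have h := green_identity_inhom (μ := lam * (lam - 2)) (μ' := 1 * (1 - 2))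
    (u := sphGreen lam f a b) (u' := sphGreen' lam f a b) (u'' := sphGreen'' lam f a b)
    (v := fun t => sph 1 (hyp t)) (v' := deriv (fun t => sph 1 (hyp t)))
    (v'' := deriv (deriv (fun t => sph 1 (hyp t))))
    (fun t ht => hasDerivAt_sphGreen hlam hf ha hab ht) (fun t ht => hasDerivAt_sphGreen' hlam hf ha hab ht)
    (fun t ht => sphGreen_ode hlam ht) (hφ_sph 1) (hφ'_sph 1) (hode_sph 1) hf hε hεR
  rw [← h]
  have hcont : ContinuousOn (fun t => f t * sph 1 (hyp t) * Real.sinh (2 * t)) (Ioi 0) :=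
    (hf.mul (continuous_sph_hyp 1).continuousOn).mul
      (Real.continuous_sinh.comp (continuous_const.mul continuous_id)).continuousOn
  have hi1 : IntervalIntegrable (fun t => f t * sph 1 (hyp t) * Real.sinh (2 * t)) volume ε a :=
    (hcont.mono (uIcc_subset_Ioi hε ha)).intervalIntegrable
  have hi2 : IntervalIntegrable (fun t => f t * sph 1 (hyp t) * Real.sinh (2 * t)) volume a b :=
    (hcont.mono (uIcc_subset_Ioi ha hb)).intervalIntegrable
  have hi3 : IntervalIntegrable (fun t => f t * sph 1 (hyp t) * Real.sinh (2 * t)) volume b R :=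
    (hcont.mono (uIcc_subset_Ioi hb hR)).intervalIntegrable
  have hz1 : ∫ t in ε..a, f t * sph 1 (hyp t) * Real.sinh (2 * t) = 0 := by
    refine (integral_congr (g := fun _ => (0 : ℝ)) fun t ht => ?_).trans integral_zero
    rw [Set.uIcc_of_le hεa] at ht
    simp only [hfa t ht.2, zero_mul]
  have hz3 : ∫ t in b..R, f t * sph 1 (hyp t) * Real.sinh (2 * t) = 0 := by
    refine (integral_congr (g := fun _ => (0 : ℝ)) fun t ht => ?_).trans integral_zero
    rw [Set.uIcc_of_le hbR] at ht
    simp only [hfb t ht.1, zero_mul]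
  rw [← integral_add_adjacent_intervals hi1 (hi2.trans hi3), ← integral_add_adjacent_intervals hi2 hi3,
    hz1, hz3, zero_add, add_zero]

include hlam hf ha hab hfa hfb in
/-- **Step A (`ε → 0⁺`)** for `v = Ξ`. -/
theorem resolvent_transform_finite_one {R : ℝ} (hbR : b ≤ R) :
    ∫ t in a..b, f t * sph 1 (hyp t) * Real.sinh (2 * t)
      = Real.sinh (2 * R) * (sph 1 (hyp R) * sphGreen' lam f a b R
            - sphGreen lam f a b R * deriv (fun t => sph 1 (hyp t)) R)
        + (1 * (1 - 2) - lam * (lam - 2)) * ∫ t in (0 : ℝ)..R, sphGreen lam f a b t * sph 1 (hyp t) * Real.sinh (2 * t) := by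
  have hb : 0 < b := lt_of_lt_of_le ha hab
  have hR : 0 < R := lt_of_lt_of_le hb hbR
  have hgint : ∀ c, 0 ≤ c →
      IntervalIntegrable (fun t => sphGreen lam f a b t * sph 1 (hyp t) * Real.sinh (2 * t)) volume 0 c := fun c hc =>
    (intervalIntegrable_iff_integrableOn_Ioc_of_le hc).mpr
      ((integrableOn_green_mul_sph_one hlam hf ha hab hfa hfb).mono_set Set.Ioc_subset_Ioi_self)
  have hconst : Tendsto (fun ε => (Real.sinh (2 * R) * (sph 1 (hyp R) * sphGreen' lam f a b R
            - sphGreen lam f a b R * deriv (fun t => sph 1 (hyp t)) R)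
          - Real.sinh (2 * ε) * (sph 1 (hyp ε) * sphGreen' lam f a b ε
            - sphGreen lam f a b ε * deriv (fun t => sph 1 (hyp t)) ε))
        + (1 * (1 - 2) - lam * (lam - 2)) * ∫ t in ε..R, sphGreen lam f a b t * sph 1 (hyp t) * Real.sinh (2 * t))
      (𝓝[>] 0) (𝓝 (∫ t in a..b, f t * sph 1 (hyp t) * Real.sinh (2 * t))) := by
    refine tendsto_const_nhds.congr' ?_
    filter_upwards [Ioo_mem_nhdsGT ha] with ε hε
    exact green_identity_resolvent_one hlam hf ha hab hfa hfb hε.1 hε.2.le hbR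
  have hlim : Tendsto (fun ε => (Real.sinh (2 * R) * (sph 1 (hyp R) * sphGreen' lam f a b R
            - sphGreen lam f a b R * deriv (fun t => sph 1 (hyp t)) R)
          - Real.sinh (2 * ε) * (sph 1 (hyp ε) * sphGreen' lam f a b ε
            - sphGreen lam f a b ε * deriv (fun t => sph 1 (hyp t)) ε))
        + (1 * (1 - 2) - lam * (lam - 2)) * ∫ t in ε..R, sphGreen lam f a b t * sph 1 (hyp t) * Real.sinh (2 * t))
      (𝓝[>] 0) (𝓝 ((Real.sinh (2 * R) * (sph 1 (hyp R) * sphGreen' lam f a b R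
            - sphGreen lam f a b R * deriv (fun t => sph 1 (hyp t)) R) - 0)
        + (1 * (1 - 2) - lam * (lam - 2)) * ((∫ t in (0 : ℝ)..R, sphGreen lam f a b t * sph 1 (hyp t) * Real.sinh (2 * t)) - 0))) := by
    have hW : Tendsto (fun ε => Real.sinh (2 * R) * (sph 1 (hyp R) * sphGreen' lam f a b R
            - sphGreen lam f a b R * deriv (fun t => sph 1 (hyp t)) R)
          - Real.sinh (2 * ε) * (sph 1 (hyp ε) * sphGreen' lam f a b ε
            - sphGreen lam f a b ε * deriv (fun t => sph 1 (hyp t)) ε)) (𝓝[>] 0) (𝓝 (Real.sinh (2 * R) * (sph 1 (hyp R) * sphGreen' lam f a b R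
            - sphGreen lam f a b R * deriv (fun t => sph 1 (hyp t)) R) - 0)) :=
      tendsto_const_nhds.sub (tendsto_green_bracket_left_one hlam hf ha hab hfa)
    have hg : Tendsto (fun ε => (∫ t in (0 : ℝ)..R, sphGreen lam f a b t * sph 1 (hyp t) * Real.sinh (2 * t))
          - ∫ t in (0 : ℝ)..ε, sphGreen lam f a b t * sph 1 (hyp t) * Real.sinh (2 * t)) (𝓝[>] 0)
        (𝓝 ((∫ t in (0 : ℝ)..R, sphGreen lam f a b t * sph 1 (hyp t) * Real.sinh (2 * t)) - 0)) :=
      tendsto_const_nhds.sub (tendsto_integral_green_mul_sph_one_nhdsGT_zero hlam hf ha hab hfa)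
    refine (hW.add (hg.const_mul (1 * (1 - 2) - lam * (lam - 2)))).congr' ?_
    filter_upwards [Ioo_mem_nhdsGT ha] with ε hε
    rw [integral_interval_sub_left (hgint R hR.le) (hgint ε hε.1.le)]
  rw [tendsto_nhds_unique hconst hlim, sub_zero, sub_zero]

include hlam hf ha hab hfa hfb in
/-- **The diagonalisation at the bottom of the spectrum**:
`(1·(1−2) − λ(λ−2)) ∫_0^∞ G_λ f · Ξ sinh 2t = ∫_a^b f Ξ sinh 2t` for every `λ > 1`. -/
theorem resolvent_transform_one :
    (1 * (1 - 2) - lam * (lam - 2)) * ∫ t in Ioi 0, sphGreen lam f a b t * sph 1 (hyp t) * Real.sinh (2 * t)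
      = ∫ t in a..b, f t * sph 1 (hyp t) * Real.sinh (2 * t) := by
  have hint := integrableOn_green_mul_sph_one hlam hf ha hab hfa hfb
  have hconst : Tendsto (fun R => Real.sinh (2 * R) * (sph 1 (hyp R) * sphGreen' lam f a b R
            - sphGreen lam f a b R * deriv (fun t => sph 1 (hyp t)) R)
        + (1 * (1 - 2) - lam * (lam - 2)) * ∫ t in (0 : ℝ)..R, sphGreen lam f a b t * sph 1 (hyp t) * Real.sinh (2 * t))
      atTop (𝓝 (∫ t in a..b, f t * sph 1 (hyp t) * Real.sinh (2 * t))) := by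
    refine tendsto_const_nhds.congr' ?_
    filter_upwards [eventually_ge_atTop b] with R hR
    exact resolvent_transform_finite_one hlam hf ha hab hfa hfb hR
  have hlim : Tendsto (fun R => Real.sinh (2 * R) * (sph 1 (hyp R) * sphGreen' lam f a b R
            - sphGreen lam f a b R * deriv (fun t => sph 1 (hyp t)) R)
        + (1 * (1 - 2) - lam * (lam - 2)) * ∫ t in (0 : ℝ)..R, sphGreen lam f a b t * sph 1 (hyp t) * Real.sinh (2 * t))
      atTop (𝓝 (0 + (1 * (1 - 2) - lam * (lam - 2)) * ∫ t in Ioi 0, sphGreen lam f a b t * sph 1 (hyp t) * Real.sinh (2 * t))) :=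
    (tendsto_green_bracket_right_one hlam hf ha hab hfb).add
      ((intervalIntegral_tendsto_integral_Ioi 0 hint tendsto_id).const_mul _)
  rw [tendsto_nhds_unique hconst hlim, zero_add]

include hlam hf ha hab hfa hfb in
/-- **The spectral multiplier at the ground state is `−1/(λ−1)²`**:
`∫_0^∞ G_λ f · Ξ sinh 2t = −(∫_0^∞ f Ξ sinh 2t)/(λ−1)²` for every `λ > 1`. -/
theorem sphTransform_sphGreen_one :
    ∫ t in Ioi 0, sphGreen lam f a b t * sph 1 (hyp t) * Real.sinh (2 * t)
      = -(∫ t in Ioi 0, f t * sph 1 (hyp t) * Real.sinh (2 * t)) / (lam - 1) ^ 2 := by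
  have hne : (lam - 1) ^ 2 ≠ 0 := pow_ne_zero 2 (by linarith)
  have hc : (1 * (1 - 2) - lam * (lam - 2)) = -(lam - 1) ^ 2 := by ring
  rw [eq_div_iff hne, integral_Ioi_eq_intervalIntegral (lam' := 1) ha hab hfa hfb,
    ← resolvent_transform_one hlam hf ha hab hfa hfb, hc]
  ring

end measure

end Summit.Ventures.HodgeRepro2.T5SU11ResolventDiagonalEdge
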